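import Literature.AnabelianGeometry.SemiGraphs.TreeSystemStarConditionLocal
import Literature.AnabelianGeometry.SemiGraphs.TemperedCompactInVerticialFinite
import HarnessLib

/-!
# Compact subgroups of `π₁^temp(𝒢)` CONFINED over a finite part of `𝔾` are verticial ([SemiAnbd] Thm 3.7 (iii))

Mochizuki, *Semi-graphs of anabelioids*, Publ. RIMS **42** (2006) [MochizukiSemiAnbd2006], §3, Theorem 3.7
(iii) pp. 40–41 ("Every compact subgroup of `π₁^temp(𝒢)` is contained in at least one verticial subgroup"),
proof p. 41 ("Since the semi-graphs `𝔾_j` are all finite, we thus conclude that we may choose a compatible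
system …") with the author's *Comments* (2020), item (6).

PROOF-ONLY file (abc-iut cell, layer L3, seat abc-iut-L3-d4 gen 7, row «B9-GENERAL-PAIR@𝒢_θ» step (GP-1);
no definition, no named fact).  The cell's ∀-countable typing of Thm 3.7 (iii) (F-1732 `CompactInVerticial`) is
REFUTED at the infinite countermodel `𝒢_θ` (abc-iut-L3-d1/d4), where the fixed points of the offending compact
subgroups ESCAPE to infinity; at FINITE `𝔾` it is a theorem (`compactInVerticialAt_of_finiteGraph`, seats
abc-iut-L3-t6/t8/t10/t11).  This file proves the common generalisation of the finite case that separates the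
two phenomena, at EVERY countable `𝒢` satisfying the hypotheses of Thm 3.7, for the tempered fundamental group
of Prop. 3.6 (canonical chart, Galois tower `𝒢.galoisLevelData`, trees `𝔾̃_n`):

* `CovObj.finite_branchPairs_over` — a finite covering has finitely many (vertex, branch, branch)-triples of
  its underlying semi-graph over a finite set `F` of vertices of `𝔾` carrying finitely many branches;
* `exists_verticial_ge_of_fixed_over_finite` — **a compact `C ≤ π₁^temp(𝒢)` all of whose fixed vertices in
  the trees `𝔾̃_i`, `i ≥ j₀`, lie over such a finite `F` is contained in a verticial subgroup** (the proof of
  p. 41 / Comments (6) run inside the finite part: the localised (∗_j) `hstar_of_noFixedBranchPairSystem_local`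
  fed with total estrangement through (I4′)_cpt `stabBranchPairCpt'_temperedPiChart`, then Comments (6)(a)–(c)
  `VerticialLevelData.conj1_of_hstar`); at a finite `𝔾` (`F = ⊤`) this is Thm 3.7 (iii) itself;
* `exists_fixed_vertex_not_over_of_forall_not_le` — contrapositive, levelwise: a compact subgroup lying in NO
  verticial subgroup fixes, at EVERY level, a tree vertex outside any given such finite `F` (its fixed points
  are not confined: they "reach arbitrarily far"), with the anchor-free and locally-finite readings
  `exists_fixed_vertex_not_over_of_anchorFree`, `exists_fixed_vertex_not_over_of_isLocallyFinite`.

So the failure of the existence sentence of Thm 3.7 (iii) at an infinite `𝔾` can only come from compact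
subgroups whose fixed points leave every finite part of `𝔾` — the escape mechanism of `𝒢_θ`.  Nothing of
[SemiAnbd] is asserted beyond what is proved; nothing here bears on [IUTchIII] Cor. 3.12; typed ≠ proved.
-/

namespace Literature.AnabelianGeometry.SemiGraphs

namespace ProfiniteSemiGraph

open CategoryTheory Topology

universe u

variable {𝒢 : ProfiniteSemiGraph.{u}}

/-! ### Finiteness over a finite part of `𝔾` -/

/-- The branches of `𝔾` abutting to the vertices of a finite set `F` are finitely many when `𝔾` is locally
finite. [cite: MochizukiSemiAnbd2006, §1 p.11] -/
theorem finite_branches_over_of_isLocallyFinite (hlf : 𝒢.graph.IsLocallyFinite) (F : Set 𝒢.graph.Vertex)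
    (hF : F.Finite) : Set.Finite {b : 𝒢.graph.Branch | ∃ v ∈ F, 𝒢.graph.abuts b = some v} := by
  have hv : ∀ v : 𝒢.graph.Vertex, Set.Finite {b : 𝒢.graph.Branch | 𝒢.graph.abuts b = some v} := by
    intro v
    refine ((hlf.finite_edges v).biUnion (t := fun e => {b : 𝒢.graph.Branch | 𝒢.graph.edgeOf b = e})
      fun e _ => ?_).subset ?_
    · obtain ⟨b₁, b₂, -, h₁, h₂, hall⟩ := 𝒢.graph.two_branches e
      exact (Set.toFinite ({b₁, b₂} : Set 𝒢.graph.Branch)).subset fun b hb => by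
        rcases hall b hb with rfl | rfl
        · exact Or.inl rfl
        · exact Or.inr rfl
    · intro b hb
      exact Set.mem_biUnion (x := 𝒢.graph.edgeOf b) ⟨b, rfl, hb⟩ rfl
  exact (hF.biUnion fun v _ => hv v).subset fun b ⟨v, hvF, hb⟩ => Set.mem_biUnion hvF hb

/-- **Finitely many branch-pair candidates over a finite part of `𝔾`**: for a finite covering `S` of `𝒢` and
a finite set `F` of vertices of `𝔾` at which only finitely many branches abut, the triples (vertex, branch,
branch) of the underlying semi-graph `𝔾_S` with the vertex over `F` and both branches abutting to it form a
finite set ("the semi-graphs `𝔾_j` are all finite", localised). [cite: MochizukiSemiAnbd2006, Thm 3.7(iii) p.41] -/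
theorem CovObj.finite_branchPairs_over (S : CovObj 𝒢) (hS : S.IsFinite) (F : Set 𝒢.graph.Vertex)
    (hF : F.Finite) (hFb : Set.Finite {b : 𝒢.graph.Branch | ∃ v ∈ F, 𝒢.graph.abuts b = some v}) :
    Set.Finite {t : S.orbitGraph.Vertex × S.orbitGraph.Branch × S.orbitGraph.Branch |
      S.orbitGraphProj.vertexMap t.1 ∈ F ∧ S.orbitGraph.abuts t.2.1 = some t.1 ∧
        S.orbitGraph.abuts t.2.2 = some t.1} := by
  classical
  haveI : ∀ v, Finite (S.SV v).obj.V := hS.finite_V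
  haveI : ∀ e, Finite (S.SE e).obj.V := hS.finite_E
  -- finitely many vertex-orbits over `F`
  have hV : Set.Finite {W : S.orbitGraph.Vertex | S.orbitGraphProj.vertexMap W ∈ F} := by
    haveI : Finite F := hF.to_subtype
    refine (Set.finite_range (fun q : Σ v : F, (S.SV v.1).obj.V =>
      (Quot.mk S.VRel ⟨q.1.1, q.2⟩ : S.OVertex))).subset ?_
    intro W hW
    induction W using Quot.ind with
    | mk q =>
      obtain ⟨v, x⟩ := q
      exact ⟨⟨⟨v, hW⟩, x⟩, rfl⟩
  -- finitely many edge-orbits over a given edge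
  have hE : ∀ e : 𝒢.graph.Edge, Set.Finite {E : S.OEdge | CovObj.OEdge.base S E = e} := by
    intro e
    refine (Set.finite_range (fun y : (S.SE e).obj.V => (Quot.mk S.ERel ⟨e, y⟩ : S.OEdge))).subset ?_
    intro E hE
    induction E using Quot.ind with
    | mk q =>
      obtain ⟨e', y⟩ := q
      cases hE
      exact ⟨y, rfl⟩
  -- finitely many branches of `𝔾_S` abutting over `F`
  have hB : Set.Finite {β : S.orbitGraph.Branch | ∃ W : S.orbitGraph.Vertex,
      S.orbitGraph.abuts β = some W ∧ S.orbitGraphProj.vertexMap W ∈ F} := by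
    refine Set.Finite.of_finite_image (f := fun β : S.orbitGraph.Branch => β.1) ?_
      Subtype.val_injective.injOn
    refine (hFb.biUnion (t := fun b => ({b} : Set 𝒢.graph.Branch) ×ˢ
      {E : S.OEdge | CovObj.OEdge.base S E = 𝒢.graph.edgeOf b})
      fun b _ => (Set.finite_singleton b).prod (hE _)).subset ?_
    rintro _ ⟨β, ⟨W, hβW, hW⟩, rfl⟩
    refine Set.mem_biUnion (x := β.1.1) ⟨S.orbitGraphProj.vertexMap W, hW,
      S.orbitGraphProj.abuts_branchMap β W hβW⟩ ?_
    exact Set.mk_mem_prod (Set.mem_singleton _) β.2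
  refine ((hV.prod (hB.prod hB))).subset ?_
  rintro ⟨W, β, β'⟩ ⟨hW, hβ, hβ'⟩
  exact ⟨hW, ⟨W, hβ, hW⟩, ⟨W, hβ', hW⟩⟩

/-! ### Confined compact subgroups are verticial -/

section Canonical

variable (𝒢) (h37 : 𝒢.Thm37Hypotheses)

/-- **COMPACT SUBGROUPS CONFINED OVER A FINITE PART OF `𝔾` ARE VERTICIAL** (Thm 3.7 (iii), first
sentence, for confined compact subgroups; see the module docstring).  For the canonical chart of Prop. 3.6
and its Galois tower of trees `𝔾̃_i`: if `C ≤ π₁^temp(𝒢)` is compact and, from some level `j₀` on, every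
`C`-fixed vertex of `𝔾̃_i` lies over the finite set `F` of vertices of `𝔾` (finitely many branches abutting
there), then `C` lies in a verticial subgroup. [cite: MochizukiSemiAnbd2006, Thm 3.7(iii) pp.40-41] -/
theorem exists_verticial_ge_of_fixed_over_finite (F : Set 𝒢.graph.Vertex) (hF : F.Finite)
    (hFb : Set.Finite {b : 𝒢.graph.Branch | ∃ v ∈ F, 𝒢.graph.abuts b = some v})
    (C : Subgroup (𝒢.temperedPiChart h37.toProp36Hypotheses).G)
    (hC : IsCompact (C : Set (𝒢.temperedPiChart h37.toProp36Hypotheses).G)) (j₀ : ℕ)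
    (hconf : ∀ i, j₀ ≤ i → ∀ y : ((𝒢.galoisLevelData h37.toProp36Hypotheses).tree i).Vertex,
      (∀ g ∈ C, ((𝒢.galoisLevelData h37.toProp36Hypotheses).treeAct h37.isCountable i g).hom.vertexMap y = y) →
        ((𝒢.galoisLevelData h37.toProp36Hypotheses).treeProj i).vertexMap y ∈ F) :
    ∃ (v : 𝒢.graph.Vertex) (H : Subgroup (𝒢.temperedPiChart h37.toProp36Hypotheses).G),
      H ∈ verticialSubgroups (𝒢.temperedPiChart h37.toProp36Hypotheses) v ∧ C ≤ H := by
  classical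
  have h36 : 𝒢.Prop36Hypotheses := h37.toProp36Hypotheses
  let Dg := 𝒢.galoisLevelData h36
  have hc := h36.isCountable
  let hconn := 𝒢.galoisLevelData_hconn h36
  let Vd : VerticialLevelData.{0} 𝒢 (𝒢.temperedPiChart h36) := verticialLevelData_temperedPiChart (h36 := h36)
  have hex : ∀ v : 𝒢.graph.Vertex, (verticialSubgroups (𝒢.temperedPiChart h36) v).Nonempty :=
    fun v => (verticialInjective_holds 𝒢 h37 (𝒢.temperedPiChart h36) v).1
  -- the trivial subgroup
  by_cases hbot : C = ⊥
  · obtain ⟨H, hH⟩ := hex (𝒢.baseVertex h36)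
    exact ⟨_, H, hH, by rw [hbot]; exact bot_le⟩
  -- the anabelioid input: a nontrivial compact subgroup fixes no compatible branch-pair system of the levels
  have hnobp := noFixedBranchPairSystem_of_isTotallyEstranged_cpt h37 (𝒢.temperedPiChart h36)
    (fun n => (Dg.S n).orbitGraph) (fun n => Dg.levelAct hc hconn n) (fun _ _ h => Dg.levelTrans h) C
    (𝒢.stabBranchPairCpt'_temperedPiChart h36 (galoisLevelData_faithfulV 𝒢 h37) C hC)
  -- the finite, transition-stable part of the levels: the vertex-orbits over `F`
  let good : ∀ i : ℕ, Set (Dg.S i).orbitGraph.Vertex := fun i => {W | (Dg.S i).orbitGraphProj.vertexMap W ∈ F}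
  have hgood_fin : ∀ i : ℕ, Set.Finite {t : (Dg.S i).orbitGraph.Vertex × (Dg.S i).orbitGraph.Branch ×
      (Dg.S i).orbitGraph.Branch | t.1 ∈ good i ∧ (Dg.S i).orbitGraph.abuts t.2.1 = some t.1 ∧
        (Dg.S i).orbitGraph.abuts t.2.2 = some t.1} :=
    fun i => (Dg.S i).finite_branchPairs_over (𝒢.galoisLevelData_isFinite h36 i) F hF hFb
  have hgood_map : ∀ ⦃i i' : ℕ⦄ (h : i ≤ i') (w : (Dg.S i').orbitGraph.Vertex),
      w ∈ good i' → (Dg.levelTrans h).vertexMap w ∈ good i := by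
    intro i i' h w hw
    have e := congrArg (fun φ => SemiGraph.Hom.vertexMap φ w) (Dg.levelTrans_proj h)
    simp only [SemiGraph.comp_vertexMap, Function.comp_apply] at e
    show (Dg.S i).orbitGraphProj.vertexMap ((Dg.levelTrans h).vertexMap w) ∈ F
    rw [e]; exact hw
  -- (∗_j) for `C` at every `j`, from the localised Kőnig step above `max j j₀`
  have hstar : ∀ j : ℕ, ∃ (i : ℕ) (h : j ≤ i), ∀ e e' : (Dg.tree i).Edge,
      (∀ γ : C, (Dg.treeAct hc i γ.1).hom.edgeMap e = e) → (∀ γ : C, (Dg.treeAct hc i γ.1).hom.edgeMap e' = e') →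
      (Dg.treeTrans h).edgeMap e = (Dg.treeTrans h).edgeMap e' := by
    intro j
    obtain ⟨i, hji, hi⟩ := SemiGraph.hstar_of_noFixedBranchPairSystem_local C Dg.tree Dg.isTree_tree
      (fun n => Dg.treeAct hc n) (fun _ _ h => Dg.treeTrans h) (fun n => (Dg.S n).orbitGraph)
      (fun n => Dg.levelAct hc hconn n) Dg.treeQuot Dg.treeQuot_isImmersion
      (fun n g => Dg.treeQuot_act hc hconn n g) (fun _ _ h => Dg.levelTrans h) Dg.levelTrans_self
      (fun _ _ _ hij hjk => Dg.levelTrans_comp hij hjk) (fun _ _ h g => Dg.levelTrans_act hc hconn h g)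
      (fun _ _ h => Dg.treeTrans_quot h) hnobp hbot (max j j₀) good hgood_fin hgood_map
      (fun i hi y hy => by
        show (Dg.S i).orbitGraphProj.vertexMap ((Dg.treeQuot i).vertexMap y) ∈ F
        exact hconf i ((le_max_right j j₀).trans hi) y fun g hg => hy ⟨g, hg⟩)
    refine ⟨i, (le_max_left j j₀).trans hji, fun e e' he he' => ?_⟩
    have hcomp := Dg.treeTrans_comp (le_max_left j j₀) hji
    have key := hi e e' he he'
    have e1 := congrArg (fun φ => SemiGraph.Hom.edgeMap φ e) hcomp
    have e2 := congrArg (fun φ => SemiGraph.Hom.edgeMap φ e') hcomp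
    simp only [SemiGraph.comp_edgeMap, Function.comp_apply] at e1 e2
    rw [← e1, ← e2, key]
  exact Vd.conj1_of_hstar C hC hex hstar

/-- **A compact subgroup lying in NO verticial subgroup is not confined: at EVERY level it fixes a tree vertex
outside any finite part of `𝔾`** (contrapositive of `exists_verticial_ge_of_fixed_over_finite`, made levelwise
by projecting deep fixed vertices along the equivariant transitions over `𝔾`).
[cite: MochizukiSemiAnbd2006, Thm 3.7(iii) pp.40-41] -/
theorem exists_fixed_vertex_not_over_of_forall_not_le (F : Set 𝒢.graph.Vertex) (hF : F.Finite)
    (hFb : Set.Finite {b : 𝒢.graph.Branch | ∃ v ∈ F, 𝒢.graph.abuts b = some v})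
    (C : Subgroup (𝒢.temperedPiChart h37.toProp36Hypotheses).G)
    (hC : IsCompact (C : Set (𝒢.temperedPiChart h37.toProp36Hypotheses).G))
    (hnot : ∀ (v : 𝒢.graph.Vertex) (H : Subgroup (𝒢.temperedPiChart h37.toProp36Hypotheses).G),
      H ∈ verticialSubgroups (𝒢.temperedPiChart h37.toProp36Hypotheses) v → ¬ C ≤ H) (i : ℕ) :
    ∃ y : ((𝒢.galoisLevelData h37.toProp36Hypotheses).tree i).Vertex,
      (∀ g ∈ C, ((𝒢.galoisLevelData h37.toProp36Hypotheses).treeAct h37.isCountable i g).hom.vertexMap y = y) ∧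
        ((𝒢.galoisLevelData h37.toProp36Hypotheses).treeProj i).vertexMap y ∉ F := by
  let Dg := 𝒢.galoisLevelData h37.toProp36Hypotheses
  have hc := h37.isCountable
  by_contra hno
  push Not at hno
  -- some deep level carries a fixed vertex outside `F` (else `C` would be verticial) — project it down
  have h1 : ¬ ∀ i', i ≤ i' → ∀ y : (Dg.tree i').Vertex, (∀ g ∈ C, (Dg.treeAct hc i' g).hom.vertexMap y = y) →
      (Dg.treeProj i').vertexMap y ∈ F := by
    intro hall
    obtain ⟨v, H, hH, hCH⟩ := 𝒢.exists_verticial_ge_of_fixed_over_finite h37 F hF hFb C hC i hall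
    exact hnot v H hH hCH
  push Not at h1
  obtain ⟨i', hii', y, hy, hyF⟩ := h1
  refine hyF ?_
  have e := congrArg (fun φ => SemiGraph.Hom.vertexMap φ y) (Dg.treeTrans_over hii')
  simp only [SemiGraph.comp_vertexMap, Function.comp_apply] at e
  rw [← e]
  refine hno _ fun g hg => ?_
  have e2 := congrArg (fun φ => SemiGraph.Hom.vertexMap φ y) (Dg.treeTrans_act hc hii' g)
  simp only [SemiGraph.comp_vertexMap, Function.comp_apply, hy g hg] at e2
  exact e2.symm

/-- **Anchor-free reading**: a nontrivial compact `C` meeting every verticial subgroup trivially fixes, at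
every level, a tree vertex outside any finite part of `𝔾`. [cite: MochizukiSemiAnbd2006, Thm 3.7(iii) pp.40-41] -/
theorem exists_fixed_vertex_not_over_of_anchorFree (F : Set 𝒢.graph.Vertex) (hF : F.Finite)
    (hFb : Set.Finite {b : 𝒢.graph.Branch | ∃ v ∈ F, 𝒢.graph.abuts b = some v})
    (C : Subgroup (𝒢.temperedPiChart h37.toProp36Hypotheses).G)
    (hC : IsCompact (C : Set (𝒢.temperedPiChart h37.toProp36Hypotheses).G)) (hC1 : C ≠ ⊥)
    (hfree : ∀ (v : 𝒢.graph.Vertex) (H : Subgroup (𝒢.temperedPiChart h37.toProp36Hypotheses).G),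
      H ∈ verticialSubgroups (𝒢.temperedPiChart h37.toProp36Hypotheses) v → C ⊓ H = ⊥) (i : ℕ) :
    ∃ y : ((𝒢.galoisLevelData h37.toProp36Hypotheses).tree i).Vertex,
      (∀ g ∈ C, ((𝒢.galoisLevelData h37.toProp36Hypotheses).treeAct h37.isCountable i g).hom.vertexMap y = y) ∧
        ((𝒢.galoisLevelData h37.toProp36Hypotheses).treeProj i).vertexMap y ∉ F :=
  𝒢.exists_fixed_vertex_not_over_of_forall_not_le h37 F hF hFb C hC
    (fun v H hH hCH => hC1 (by rw [← inf_eq_left.mpr hCH]; exact hfree v H hH)) i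

/-- **Locally finite reading**: at a locally finite `𝔾` the branch-finiteness over `F` is automatic.
[cite: MochizukiSemiAnbd2006, Thm 3.7(iii) pp.40-41] -/
theorem exists_fixed_vertex_not_over_of_isLocallyFinite (hlf : 𝒢.graph.IsLocallyFinite)
    (F : Set 𝒢.graph.Vertex) (hF : F.Finite)
    (C : Subgroup (𝒢.temperedPiChart h37.toProp36Hypotheses).G)
    (hC : IsCompact (C : Set (𝒢.temperedPiChart h37.toProp36Hypotheses).G))
    (hnot : ∀ (v : 𝒢.graph.Vertex) (H : Subgroup (𝒢.temperedPiChart h37.toProp36Hypotheses).G),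
      H ∈ verticialSubgroups (𝒢.temperedPiChart h37.toProp36Hypotheses) v → ¬ C ≤ H) (i : ℕ) :
    ∃ y : ((𝒢.galoisLevelData h37.toProp36Hypotheses).tree i).Vertex,
      (∀ g ∈ C, ((𝒢.galoisLevelData h37.toProp36Hypotheses).treeAct h37.isCountable i g).hom.vertexMap y = y) ∧
        ((𝒢.galoisLevelData h37.toProp36Hypotheses).treeProj i).vertexMap y ∉ F :=
  𝒢.exists_fixed_vertex_not_over_of_forall_not_le h37 F hF (finite_branches_over_of_isLocallyFinite hlf F hF)
    C hC hnot i

/-- **Finite `𝔾` (sanity check, the case `F = ⊤`)**: at a finite `𝔾` every compact subgroup of the canonical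
`π₁^temp(𝒢)` lies in a verticial subgroup — Thm 3.7 (iii), first sentence, recovered from the confined form.
[cite: MochizukiSemiAnbd2006, Thm 3.7(iii) pp.40-41] -/
theorem exists_verticial_ge_of_finite_graph [Finite 𝒢.graph.Vertex] [Finite 𝒢.graph.Edge]
    (C : Subgroup (𝒢.temperedPiChart h37.toProp36Hypotheses).G)
    (hC : IsCompact (C : Set (𝒢.temperedPiChart h37.toProp36Hypotheses).G)) :
    ∃ (v : 𝒢.graph.Vertex) (H : Subgroup (𝒢.temperedPiChart h37.toProp36Hypotheses).G),
      H ∈ verticialSubgroups (𝒢.temperedPiChart h37.toProp36Hypotheses) v ∧ C ≤ H :=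
  haveI := 𝒢.graph.finite_branch
  𝒢.exists_verticial_ge_of_fixed_over_finite h37 Set.univ Set.finite_univ (Set.toFinite _) C hC 0
    (fun _ _ _ _ => Set.mem_univ _)

end Canonical

end ProfiniteSemiGraph

end Literature.AnabelianGeometry.SemiGraphs
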